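import Literature.NumberTheory.IwasawaTheory.ClassicalMuVanishesQuadraticAscentRat
import Literature.NumberTheory.NumberFields.QuadraticRamifiedPrimesBound
import HarnessLib

/-!
# Iwasawa's `μ₂ = 0` ascends `K(√m)/K` over `ℚ` when `K` has at most one real embedding and `K(√m)` is totally complex — all hypotheses
# of the quadratic ascent discharged (the ramified primes of the layers counted; proved, no definition, no named fact)

`Proofs`-style file (theorems only) in topic `NumberTheory/IwasawaTheory` (namespace `Literature.NumberTheory.IwasawaTheory`), written by the
prover seat `cruxlead-stmt-BirchSwinnertonDyer-19573-w2` GEN 7 (cell `bsd-2adic`; `--supports` stmt-BirchSwinnertonDyer-19573). Module (E-b) of the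
seat's «Iwasawa ℓ = 2 ascent with real places»: the per-layer bound on the ramified primes (hypothesis `hram` of
`classicalMuVanishes_restrict_rat_of_quadratic_of_subsingleton_realEmbedding`) is DISCHARGED for `K' = K(x)`, `x² = m ∈ 𝓞_K`: in the layer
`B_n = A_n(x)` a ramified prime of `A_n = j(K)·ℚ_n` contains `4m` (tree `QuadraticRamifiedPrimesBound`), hence lies over a prime factor of
`N₀ = N(4m·𝓞_K)`, and there are at most `[K:ℚ]·ℓ²` primes of `A_n` over each `ℓ` (`ℚ_n ⊆ ℚ(ζ_{2^{n+2}})`, conv-1's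
`ncard_primesOver_layer_two_le_sq`). RESULT: **`classicalMuVanishes_restrict_rat_of_sq_eq`** — `κ` cyclotomic over `ℚ`, `K ⊆ K'` number fields,
`[K' : K] = 2`, `K' = K(x)` with `x² = m ∈ 𝓞_K ∖ 0`, `K'` totally complex, `K` with at most one real embedding, `κ ∘ res` onto for both:
`ClassicalMuVanishes (κ|_K) ⟹ ClassicalMuVanishes (κ|_{K'})`. Intended use (cell bsd-2adic): `K = ℚ(P)` the cubic point field of an elliptic
`E/ℚ` with `Δ_E < 0` (one real place), `K' = ℚ(E[2]) = K(√Δ)`: cubic `μ₂`-certificates become statement (A) at `2` through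
`TotallyComplexMu.conjA_two_of_classicalMu_divisionField_two_of_Δ_neg`.

References: [Iwasawa1973MuInvariants] Thm. 2/3, §4; [Washington1997] §13.1, §13.3; [NeukirchANT1999] Ch. III (2.6), Ch. I §8.
-/

set_option autoImplicit false

noncomputable section

open scoped NumberField Classical
open NumberField Field IntermediateField IsDedekindDomain

namespace Literature.NumberTheory.IwasawaTheory

open Literature.NumberTheory.EllipticCurves Literature.NumberTheory.EllipticCurves.ZpExtension
  Literature.NumberTheory.GaloisRepresentations Literature.NumberTheory.NumberFields

variable (κ : ZpExtension ℚ 2)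

/-- An integral element of `K'` gives an integral element of the layer `j'(K')·ℚ_n`. [folklore] -/
private theorem isIntegral_mk_of_isIntegral {L : IntermediateField ℚ (AlgebraicClosure ℚ)} {y : AlgebraicClosure ℚ} (hy : y ∈ L)
    (hint : IsIntegral ℤ y) : IsIntegral ℤ (⟨y, hy⟩ : ↥L) :=
  (isIntegral_algHom_iff (IsScalarTower.toAlgHom ℤ ↥L (AlgebraicClosure ℚ)) Subtype.val_injective).mp hint

set_option maxHeartbeats 400000 in
/-- **Iwasawa's `μ₂ = 0` ascends `K(√m)/K` over `ℚ`** (`κ` the cyclotomic `ℤ₂`-extension of `ℚ`; `K ⊆ K'` number fields with `[K' : K] = 2`,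
`K' = K(x)`, `x ∈ 𝓞_{K'}`, `x² = m ∈ 𝓞_K`, `m ≠ 0`; `K'` totally complex; `K` with at most one real embedding; `κ ∘ res` onto for `K` and `K'`):
`ClassicalMuVanishes (κ|_K) ⟹ ClassicalMuVanishes (κ|_{K'})`. The ramified primes of the layers `A_n = j(K)·ℚ_n ⊆ B_n = A_n(x)` contain `4m`,
so lie over the prime factors of `N₀ = N(4m 𝓞_K)`, at most `[K : ℚ]·ℓ²` over each `ℓ`; the signature hypothesis is the units of `ℚ_n`
(`ClassicalMuVanishesQuadraticAscentRat`). [cite: Iwasawa1973MuInvariants, Thm. 2 and Thm. 3, §4] [cite: Washington1997, §13.1 and §13.3 Prop. 13.23]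
[cite: NeukirchANT1999, Ch. III (2.6)] -/
theorem classicalMuVanishes_restrict_rat_of_sq_eq (hκ : κ.IsCyclotomic)
    (K K' : Type) [Field K] [NumberField K] [Field K'] [NumberField K'] [Algebra K K'] [IsTotallyComplex K']
    [Subsingleton (K →+* ℝ)] (hdeg : Module.finrank K K' = 2)
    {x : 𝓞 K'} {m : 𝓞 K} (hm : m ≠ 0) (hx : x ^ 2 = algebraMap (𝓞 K) (𝓞 K') m) (hgen : Algebra.adjoin K {(x : K')} = ⊤)
    (hK : Function.Surjective (κ.toContinuousMonoidHom.comp (absGaloisRestrict ℚ K)))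
    (hK' : Function.Surjective (κ.toContinuousMonoidHom.comp (absGaloisRestrict ℚ K')))
    (hμ : ClassicalMuVanishes (κ.restrict K hK)) :
    ClassicalMuVanishes (κ.restrict K' hK') := by
  haveI : Fact (Nat.Prime 2) := ⟨Nat.prime_two⟩
  haveI : FiniteDimensional K K' := Module.Finite.of_restrictScalars_finite ℚ K K'
  set j' : K' →ₐ[ℚ] AlgebraicClosure ℚ := absEmbedding ℚ K' with hj'
  set j : K →ₐ[ℚ] AlgebraicClosure ℚ := j'.comp (IsScalarTower.toAlgHom ℚ K K') with hj
  -- the integer `N₀ = N(4m)` whose prime factors control the ramified primes of every layer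
  set N₀ : ℕ := Ideal.absNorm (Ideal.span {(4 * m : 𝓞 K)}) with hN₀
  have h4m0 : (4 * m : 𝓞 K) ≠ 0 := mul_ne_zero (by norm_num) hm
  have hN₀0 : (N₀ : ℤ) ≠ 0 := by
    rw [hN₀]
    exact_mod_cast (Ideal.absNorm_eq_zero_iff.not.mpr (mt Ideal.span_singleton_eq_bot.mp h4m0))
  have hdvdK : (4 * m : 𝓞 K) ∣ ((N₀ : ℤ) : 𝓞 K) := by
    rw [← Ideal.mem_span_singleton]
    have h := Ideal.absNorm_mem (Ideal.span {(4 * m : 𝓞 K)})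
    rw [← hN₀] at h
    exact_mod_cast h
  set T : ℕ := ∑ ℓ ∈ (N₀ : ℤ).natAbs.primeFactors, Module.finrank ℚ K * ℓ ^ 2 with hT
  refine classicalMuVanishes_restrict_rat_of_quadratic_of_subsingleton_realEmbedding κ hκ K K' hdeg hK hK' j' T (fun n ↦ ?_) hμ
  -- the layer `A = j(K)·ℚ_n ⊆ B = j'(K')·ℚ_n`
  set L : IntermediateField ℚ (AlgebraicClosure ℚ) := κ.layer n with hL
  set A : IntermediateField ℚ (AlgebraicClosure ℚ) := j.fieldRange ⊔ L with hA
  set B : IntermediateField ℚ (AlgebraicClosure ℚ) := j'.fieldRange ⊔ L with hB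
  have hAB : A ≤ B := fieldRange_comp_sup_layer_le κ K K' j' n
  haveI : NumberField ↥A := numberField_fieldRange_sup_layer κ K j n
  haveI : NumberField ↥B := numberField_fieldRange_sup_layer κ K' j' n
  letI : Algebra ↥A ↥B := (IntermediateField.inclusion hAB).toRingHom.toAlgebra
  haveI : IsScalarTower ℚ ↥A ↥B := IsScalarTower.of_algebraMap_eq fun _ ↦ rfl
  haveI : Module.Free ↥A ↥B := Module.Free.of_divisionRing ↥A ↥B
  haveI : FiniteDimensional ↥A ↥B := Module.Finite.of_restrictScalars_finite ℚ ↥A ↥B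
  haveI : FiniteDimensional ℚ ↥L := κ.finiteDimensional_layer_holds n
  haveI : NumberField ↥L := NumberField.of_module_finite ℚ _
  -- degrees
  have hdA : Module.finrank ℚ ↥A = Module.finrank ℚ K * 2 ^ n := finrank_fieldRange_sup_layer κ K hK j n
  have hdB : Module.finrank ℚ ↥B = Module.finrank ℚ K' * 2 ^ n := finrank_fieldRange_sup_layer κ K' hK' j' n
  have hdegAB : Module.finrank ↥A ↥B = 2 := by
    have htower := Module.finrank_mul_finrank ℚ ↥A ↥B
    have hKK' := Module.finrank_mul_finrank ℚ K K'
    have h1 : Module.finrank ℚ ↥A * Module.finrank ↥A ↥B = Module.finrank ℚ ↥A * 2 := by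
      rw [htower, hdB, hdA, ← hKK', hdeg]; ring
    exact Nat.eq_of_mul_eq_mul_left Module.finrank_pos h1
  haveI : Algebra.IsQuadraticExtension ↥A ↥B := ⟨hdegAB⟩
  haveI : IsGalois ↥A ↥B := inferInstance
  -- the generator in the layer: `x_B² = m_A`, `B = A(x_B)`
  have hjA : j.fieldRange ≤ A := le_sup_left
  have hj'B : j'.fieldRange ≤ B := le_sup_left
  have hLA : L ≤ A := le_sup_right
  have hmA : (j ((m : 𝓞 K) : K)) ∈ A := hjA ⟨(m : K), rfl⟩
  have hxB : (j' ((x : 𝓞 K') : K')) ∈ B := hj'B ⟨(x : K'), rfl⟩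
  let mA : 𝓞 ↥A := ⟨⟨j ((m : 𝓞 K) : K), hmA⟩, isIntegral_mk_of_isIntegral hmA (map_isIntegral_int j m.isIntegral_coe)⟩
  let xB : 𝓞 ↥B := ⟨⟨j' ((x : 𝓞 K') : K'), hxB⟩, isIntegral_mk_of_isIntegral hxB (map_isIntegral_int j' x.isIntegral_coe)⟩
  have hjm : j ((m : 𝓞 K) : K) = j' (algebraMap K K' ((m : 𝓞 K) : K)) := rfl
  have hx' : ((x : 𝓞 K') : K') ^ 2 = algebraMap K K' ((m : 𝓞 K) : K) := by
    have h := congrArg (fun z : 𝓞 K' ↦ (z : K')) hx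
    have e1 : (((x ^ 2 : 𝓞 K') : 𝓞 K') : K') = ((x : 𝓞 K') : K') ^ 2 := by push_cast; rfl
    have e2 : (((algebraMap (𝓞 K) (𝓞 K') m : 𝓞 K') : 𝓞 K') : K') = algebraMap K K' ((m : 𝓞 K) : K) := rfl
    rw [← e1, ← e2]
    exact h
  have hxB2 : xB ^ 2 = algebraMap (𝓞 ↥A) (𝓞 ↥B) mA := by
    apply RingOfIntegers.ext
    apply Subtype.ext
    change (j' ((x : 𝓞 K') : K')) ^ 2 = j ((m : 𝓞 K) : K)
    rw [← map_pow, hx', hjm]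
  -- `B = A(x_B)`
  have hgenB : Algebra.adjoin ↥A {((xB : 𝓞 ↥B) : ↥B)} = ⊤ := by
    set Tad : Subalgebra ↥A ↥B := Algebra.adjoin ↥A {((xB : 𝓞 ↥B) : ↥B)} with hTad
    -- the elements of `ℚ̄` lying in `B` whose class is in `Tad`
    let S : Subalgebra ℚ (AlgebraicClosure ℚ) :=
      { carrier := {y | ∃ hy : y ∈ B, (⟨y, hy⟩ : ↥B) ∈ Tad}
        mul_mem' := by
          rintro a b ⟨ha, ha'⟩ ⟨hb, hb'⟩
          exact ⟨mul_mem ha hb, by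
            have e : (⟨a * b, mul_mem ha hb⟩ : ↥B) = ⟨a, ha⟩ * ⟨b, hb⟩ := rfl
            rw [e]; exact Tad.mul_mem ha' hb'⟩
        one_mem' := ⟨one_mem _, by
          have e : (⟨1, one_mem _⟩ : ↥B) = 1 := rfl
          rw [e]; exact Tad.one_mem⟩
        add_mem' := by
          rintro a b ⟨ha, ha'⟩ ⟨hb, hb'⟩
          exact ⟨add_mem ha hb, by
            have e : (⟨a + b, add_mem ha hb⟩ : ↥B) = ⟨a, ha⟩ + ⟨b, hb⟩ := rfl
            rw [e]; exact Tad.add_mem ha' hb'⟩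
        zero_mem' := ⟨zero_mem _, by
          have e : (⟨0, zero_mem _⟩ : ↥B) = 0 := rfl
          rw [e]; exact Tad.zero_mem⟩
        algebraMap_mem' := fun r ↦ ⟨IntermediateField.algebraMap_mem B r, Tad.algebraMap_mem (algebraMap ℚ ↥A r)⟩ }
    -- `A ⊆ S`
    have hAS : ∀ y (hy : y ∈ A), y ∈ S := fun y hy ↦ ⟨hAB hy, by
      have e : (⟨y, hAB hy⟩ : ↥B) = algebraMap ↥A ↥B ⟨y, hy⟩ := rfl
      rw [e]; exact Tad.algebraMap_mem _⟩
    -- `j'(K') ⊆ S`: every element of `K'` is a polynomial in `x` over `K`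
    have hK'S : j'.fieldRange.toSubalgebra ≤ S := by
      rintro _ ⟨y, rfl⟩
      have hy : (y : K') ∈ Algebra.adjoin K {((x : 𝓞 K') : K')} := by rw [hgen]; exact Algebra.mem_top
      induction hy using Algebra.adjoin_induction with
      | mem z hz =>
        rw [Set.mem_singleton_iff] at hz
        subst hz
        exact ⟨hxB, Algebra.subset_adjoin (Set.mem_singleton _)⟩
      | algebraMap r =>
        have : j' (algebraMap K K' r) = j r := rfl
        rw [AlgHom.toRingHom_eq_coe, RingHom.coe_coe, this]
        exact hAS _ (hjA ⟨r, rfl⟩)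
      | add a b _ _ ha hb =>
        rw [AlgHom.toRingHom_eq_coe, RingHom.coe_coe, map_add]
        exact S.add_mem ha hb
      | mul a b _ _ ha hb =>
        rw [AlgHom.toRingHom_eq_coe, RingHom.coe_coe, map_mul]
        exact S.mul_mem ha hb
    have hLS : L.toSubalgebra ≤ S := fun y hy ↦ hAS y (hLA hy)
    have hBS : B.toSubalgebra ≤ S := by
      haveI : Algebra.IsAlgebraic ℚ ↥L := Algebra.IsAlgebraic.of_finite ℚ ↥L
      rw [hB, IntermediateField.sup_toSubalgebra_of_isAlgebraic_right]
      exact sup_le hK'S hLS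
    rw [eq_top_iff]
    rintro ⟨y, hy⟩ -
    obtain ⟨hy', h⟩ := hBS hy
    exact h
  -- count: ramified primes contain `4 m_A`, which divides `N₀`
  have hmA0 : mA ≠ 0 := by
    intro h0
    apply hm
    have h1 : ((mA : 𝓞 ↥A) : ↥A) = 0 := by rw [h0]; rfl
    have h2 : j ((m : 𝓞 K) : K) = 0 := by
      have := congrArg Subtype.val h1
      rwa [ZeroMemClass.coe_zero] at this
    rw [map_eq_zero_iff j j.injective] at h2
    exact RingOfIntegers.ext (by simpa using h2)
  let ψ : 𝓞 K →+* 𝓞 ↥A :=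
    { toFun := fun k ↦ ⟨⟨j ((k : 𝓞 K) : K), hjA ⟨(k : K), rfl⟩⟩,
        isIntegral_mk_of_isIntegral _ (map_isIntegral_int j k.isIntegral_coe)⟩
      map_one' := by apply RingOfIntegers.ext; apply Subtype.ext; simp
      map_mul' := fun a b ↦ by apply RingOfIntegers.ext; apply Subtype.ext; simp
      map_zero' := by apply RingOfIntegers.ext; apply Subtype.ext; simp
      map_add' := fun a b ↦ by apply RingOfIntegers.ext; apply Subtype.ext; simp }
  have hψm : ψ m = mA := rfl
  have hdvdA : (4 * mA : 𝓞 ↥A) ∣ (((N₀ : ℤ) : 𝓞 ↥A)) := by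
    have h := map_dvd ψ hdvdK
    rw [map_mul, hψm, map_intCast] at h
    have e4 : ψ 4 = 4 := by rw [show (4 : 𝓞 K) = ((4 : ℤ) : 𝓞 K) by norm_cast, map_intCast]; norm_cast
    rwa [e4] at h
  have hram1 := ncard_ramified_le_ncard_mem hxB2 hgenB hmA0
  have hram2 := ncard_setOf_mem_le_sum_primesOver (F := ↥A) hN₀0 hdvdA
  -- primes of `A` over `ℓ`: at most `[K : ℚ]·ℓ²`
  letI : Algebra ↥L ↥A := (IntermediateField.inclusion hLA).toRingHom.toAlgebra
  haveI : IsScalarTower ℚ ↥L ↥A := IsScalarTower.of_algebraMap_eq fun _ ↦ rfl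
  haveI : Module.Free ↥L ↥A := Module.Free.of_divisionRing ↥L ↥A
  have hdegLA : Module.finrank ↥L ↥A = Module.finrank ℚ K := by
    have htower := Module.finrank_mul_finrank ℚ ↥L ↥A
    have hLd : Module.finrank ℚ ↥L = 2 ^ n := κ.finrank_layer_holds n
    rw [hdA, hLd] at htower
    have h2n : 0 < 2 ^ n := pow_pos two_pos n
    rw [mul_comm] at htower
    exact Nat.eq_of_mul_eq_mul_right h2n (by rw [htower, mul_comm])
  have hfib : ∀ ℓ ∈ (N₀ : ℤ).natAbs.primeFactors,
      ((Ideal.span {(ℓ : ℤ)}).primesOver (𝓞 ↥A)).ncard ≤ Module.finrank ℚ K * ℓ ^ 2 := fun ℓ hℓ ↦ by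
    have hℓp : ℓ.Prime := Nat.prime_of_mem_primeFactors hℓ
    refine (ncard_primesOver_le_finrank_mul ↥L ↥A hℓp).trans ?_
    rw [hdegLA]
    exact Nat.mul_le_mul_left _ (ncard_primesOver_layer_two_le_sq hκ n hℓp)
  calc {v : HeightOneSpectrum (𝓞 ↥A) | v.asIdeal.ramificationIdxIn (𝓞 ↥B) ≠ 1}.ncard
      ≤ {v : HeightOneSpectrum (𝓞 ↥A) | 4 * mA ∈ v.asIdeal}.ncard := hram1
    _ ≤ ∑ ℓ ∈ (N₀ : ℤ).natAbs.primeFactors, ((Ideal.span {(ℓ : ℤ)}).primesOver (𝓞 ↥A)).ncard := hram2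
    _ ≤ T := Finset.sum_le_sum hfib

end Literature.NumberTheory.IwasawaTheory

end
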